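/-
Copyright: the b2b-balaban cell (near-miss cell 7), T⁴-continuum CRUX team (coordinator ruling e34b3e0c item (2)),
seat t4-ne7b-formalise-leaf-06 (gen 28). Released under the licence of the surrounding project.
-/
import Summits.QuantumFields.BalabanUV.T4Continuum.Spine.NE7b.LatticeSubsolutionBarrier

/-!
# The energy-quantum lemma for lattice subsolutions with a quadratic source (discrete ε-regularity)
# (route NE7b R-H, `t4/ROUTES-NE7b.md` v6.1 Δv6 item 3: (T-k5) LEMMA (μ) and the scalar DICHOTOMY (L1))

Cell `pub-balaban`, sub-cell `t4`, spine estimate NE7b (node U5c), candidate route R-H ∕ C-RH°. ROUTES-NE7b v6 (seat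
`t4-ne7b-idea-1` gen 6, signature pack S-k5 addressed to this seat; refuter PRICING-NE7b v6 F31 «(T-k5)∕(L1) item 3(a)
ACCEPTED [K-typable]») adds to the PH-k family the law-free ENERGY-QUANTUM LEMMA about ONE function `s : ℤ^d → ℝ`:
  (μ) (i) `2d·s(x) ≤ Σ_{λ,±} s(x ± e_λ) + C′M²` on a finite `I`; (ii) `s ≤ b` on the outer layer of `I`; (iii)
  `M > (1+η)·b`, `M ≤ max_I s` ⇒ in `d = 4`, `Σ_{x∈I} s(x)² ≥ q(η, C′)` INDEPENDENT OF `M`.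
PROOF ROUTE = ROUTES item 3 (averaging operator with boundary value `b`, iterate `N ≈ 4η∕((1+η)C′M)` times, killed
kernel ≤ free kernel) with ONE change of bookkeeping: instead of Cauchy–Schwarz + `Σ_y P^N(p₀,y)² = P^{2N}(0,0)` (which needs
symmetry, translation invariance and Chapman–Kolmogorov) we use HÖLDER WITH THE ROW MASS `Σ_y K_N(p₀,y) ≤ 1`:
`(Σ_y K_N(p₀,y)s(y))² ≤ sup_y P_N(p₀,y)·Σ_I s²`. The ONLY analytic input is the uniform heat-kernel bound
`n²·P_n(x,y) ≤ C` on `ℤ⁴`, carried as a NAMED HYPOTHESIS `hC` (S-k5: «the return bound as a named hypothesis … or proved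
by Fourier») = the uniform corollary of the local central limit theorem, Lawler, *Intersections of Random Walks* (1991)
Thm 1.2.1 (1.10), p. 11 (`n²·sup_x p_n(x) → 8∕π²` in `d = 4`, ROUTES' `C_hk`); any proved `C` serves.
* §1 `avg` and its affine bookkeeping; §2 `srwKernel` (free kernel, first-step recursion), `killedKernel I` (killed outside
  `I`): `0 ≤ killed ≤ free ≤ 1`, killed row mass `≤ 1`, `P_1(x, x+e_λ) ≥ 1∕2d`;
* §3 **`le_iterBound`**: `s(x) ≤ Σ_{y∈I} K_n(x,y)s(y) + b(1 − Σ_{y∈I}K_n(x,y)) + nκ∕2d` on `I`;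
* §4 **`dispersion_bound`** (THEOREM A, every `d ≥ 1`, every `n`): `s(p₀) ≤ √(ψ·Σ_{y∈I}s(y)²) + b + nκ∕2d` if `P_n(p₀,·) ≤ ψ`;
* §5 **`energy_quantum`** (THEOREM B = (μ), `d = 4`, hypothesis `hC`): `Σ_{x∈I} s(x)² ≥ η⁴∕((1+η)⁴·C·C′²)` (the sup-form
  of the input and the floor bookkeeping cost the factor `4 = 2^{d∕2}` against ROUTES' `4η⁴∕((1+η)⁴C_hkC′²)`);
  **`dichotomy`** ((L1), scalar form): EITHER `max_I s ≤ (1+η)·b` OR `Σ_I s² ≥ η⁴∕((1+η)⁴·C·C′²)`.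

HONEST FRAMING. Law-free lattice analysis; `hC` is a hypothesis binder (a published heat-kernel bound, locator above),
not proved here; nothing of (MP<L²)'s clauses, nothing of [Bałaban 1983–89] asserted or cited. NE7b
(`T4WeightBudget.RelWeightBound`) NOT PRINTED and NOT PROVED; spine PROVED 0∕9; rung (B)+1 on a FINITE torus T⁴ — NOT
infinite volume, NOT the mass gap, NOT Clay. HONEST DEPENDENCY: continuum YM on T⁴ ⇐ BetaPertH ∧ nine spine estimates
(0/9 proved); BetaPertH ⇐ (D1) ∧ (D4) ∧ CAP+tail; G-an2-4 gates asym, D1 and NE2/3/4. POLICY: crux-route work under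
`Spine/NE7b/` requested by name (ROUTES v6 §10 S-k5), not a `T4Continuum/Support` leaf (FREEZE (0) respected); four
concrete definitions, no `Prop`-valued fact, no `[cite:]` fact.
-/

set_option autoImplicit false

noncomputable section

namespace Summit.QuantumFields.BalabanUV.T4Continuum.NE7b.EnergyQuantumLemma

open Finset
open scoped BigOperators
open Literature.Probability.LatticeModels (Site)
open Summit.QuantumFields.BalabanUV.T4Continuum.NE7b.AbelianCurvatureMaximumPrinciple (e layer mem_layer_of_not_mem)

variable {d : ℕ}

/-! ## §1 The averaging operator -/

/-- The nearest-neighbour averaging operator `(avg f)(x) = (1∕2d)·Σ_λ (f(x+e_λ) + f(x−e_λ))` (the one-step transition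
operator of simple random walk on `ℤ^d`). -/
def avg (f : Site d → ℝ) (x : Site d) : ℝ :=
  (1 / (2 * (d : ℝ))) * ∑ l : Fin d, (f (x + e l) + f (x - e l))

/-- `avg` is additive. -/
theorem avg_add (f g : Site d → ℝ) (x : Site d) : avg (fun z => f z + g z) x = avg f x + avg g x := by
  simp only [avg, Finset.sum_add_distrib]
  ring

/-- `avg` respects subtraction. -/
theorem avg_sub (f g : Site d → ℝ) (x : Site d) : avg (fun z => f z - g z) x = avg f x - avg g x := by
  simp only [avg, Finset.sum_sub_distrib, Finset.sum_add_distrib]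
  ring

/-- `avg` commutes with left scalar multiplication. -/
theorem avg_mul_left (c : ℝ) (f : Site d → ℝ) (x : Site d) : avg (fun z => c * f z) x = c * avg f x := by
  simp only [avg, ← mul_add, ← Finset.mul_sum]
  ring

/-- `avg` commutes with right scalar multiplication. -/
theorem avg_mul_right (f : Site d → ℝ) (c : ℝ) (x : Site d) : avg (fun z => f z * c) x = avg f x * c := by
  simp only [avg, ← add_mul, ← Finset.sum_mul]
  ring

/-- `avg` commutes with finite sums. -/
theorem avg_sum {ι : Type*} (t : Finset ι) (F : ι → Site d → ℝ) (x : Site d) :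
    avg (fun z => ∑ i ∈ t, F i z) x = ∑ i ∈ t, avg (F i) x := by
  simp only [avg]
  rw [← Finset.mul_sum]
  congr 1
  rw [Finset.sum_comm]
  exact Finset.sum_congr rfl fun l _ => Finset.sum_add_distrib.symm

/-- `avg` of a constant is the constant (`d ≥ 1`). -/
theorem avg_const (hd : 0 < d) (c : ℝ) (x : Site d) : avg (fun _ => c) x = c := by
  simp only [avg, Finset.sum_const, Finset.card_univ, Fintype.card_fin, nsmul_eq_mul]
  have : (d : ℝ) ≠ 0 := by exact_mod_cast hd.ne'
  field_simp
  ring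

/-- `avg` is monotone in the values on the `2d` neighbours. -/
theorem avg_mono {f g : Site d → ℝ} {x : Site d} (h : ∀ l : Fin d, f (x + e l) ≤ g (x + e l) ∧ f (x - e l) ≤ g (x - e l)) :
    avg f x ≤ avg g x := by
  unfold avg
  exact mul_le_mul_of_nonneg_left (Finset.sum_le_sum fun l _ => add_le_add (h l).1 (h l).2) (by positivity)

/-- `avg` of a function nonnegative on the neighbours is nonnegative. -/
theorem avg_nonneg {f : Site d → ℝ} {x : Site d} (h : ∀ l : Fin d, 0 ≤ f (x + e l) ∧ 0 ≤ f (x - e l)) : 0 ≤ avg f x := by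
  unfold avg
  exact mul_nonneg (by positivity) (Finset.sum_nonneg fun l _ => add_nonneg (h l).1 (h l).2)

/-! ## §2 The free and the killed kernel -/

/-- The `n`-step kernel `P_n(x,y)` of simple random walk on `ℤ^d`, by first-step recursion:
`P_0(x,y) = [x = y]`, `P_{n+1}(x,y) = (1∕2d)·Σ_{λ,±} P_n(x ± e_λ, y)`. -/
def srwKernel : ℕ → Site d → Site d → ℝ
  | 0, x, y => if x = y then 1 else 0
  | n + 1, x, y => avg (fun z => srwKernel n z y) x

/-- The kernel KILLED OUTSIDE `I`: `K_0(x,y) = [x = y ∈ I]`, `K_{n+1}(x,y) = [x ∈ I]·(1∕2d)·Σ_{λ,±} K_n(x ± e_λ, y)` — the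
walk is stopped (and its mass discarded) at its first visit outside `I`, including at time `0`. -/
def killedKernel (I : Finset (Site d)) : ℕ → Site d → Site d → ℝ
  | 0, x, y => if x ∈ I ∧ x = y then 1 else 0
  | n + 1, x, y => if x ∈ I then avg (fun z => killedKernel I n z y) x else 0

/-- `P_n ≥ 0`. -/
theorem srwKernel_nonneg : ∀ (n : ℕ) (x y : Site d), 0 ≤ srwKernel n x y
  | 0, x, y => by simp only [srwKernel]; split_ifs <;> norm_num
  | n + 1, x, y => avg_nonneg fun l => ⟨srwKernel_nonneg n _ _, srwKernel_nonneg n _ _⟩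

/-- One step reaches each neighbour with probability at least `1∕2d`: `P_1(x, x+e_λ) ≥ 1∕2d`. -/
theorem srwKernel_one_neighbour_ge (x : Site d) (l : Fin d) : 1 / (2 * (d : ℝ)) ≤ srwKernel 1 x (x + e l) := by
  simp only [srwKernel, avg]
  have h0 : ∀ i : Fin d, (0 : ℝ) ≤ (if x + e i = x + e l then (1 : ℝ) else 0) + (if x - e i = x + e l then 1 else 0) :=
    fun i => add_nonneg (by split_ifs <;> norm_num) (by split_ifs <;> norm_num)
  have h1 : (1 : ℝ) ≤ ∑ l' : Fin d, ((if x + e l' = x + e l then (1 : ℝ) else 0) + (if x - e l' = x + e l then 1 else 0)) := by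
    refine le_trans ?_ (Finset.single_le_sum (fun i _ => h0 i) (Finset.mem_univ l))
    have : (0 : ℝ) ≤ if x - e l = x + e l then 1 else 0 := by split_ifs <;> norm_num
    simp only [if_true]
    linarith
  calc 1 / (2 * (d : ℝ)) = 1 / (2 * (d : ℝ)) * 1 := (mul_one _).symm
    _ ≤ _ := mul_le_mul_of_nonneg_left h1 (by positivity)

/-- `K_n ≥ 0`. -/
theorem killedKernel_nonneg (I : Finset (Site d)) : ∀ (n : ℕ) (x y : Site d), 0 ≤ killedKernel I n x y
  | 0, x, y => by simp only [killedKernel]; split_ifs <;> norm_num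
  | n + 1, x, y => by
      simp only [killedKernel]
      split_ifs
      exacts [avg_nonneg fun l => ⟨killedKernel_nonneg I n _ _, killedKernel_nonneg I n _ _⟩, le_rfl]

/-- The killed kernel vanishes from points outside `I`. -/
theorem killedKernel_of_not_mem {I : Finset (Site d)} {x : Site d} (hx : x ∉ I) (n : ℕ) (y : Site d) :
    killedKernel I n x y = 0 := by
  cases n <;> simp [killedKernel, hx]

/-- DOMINATION: `K_n(x,y) ≤ P_n(x,y)` (killing only removes mass). -/
theorem killedKernel_le_srwKernel (I : Finset (Site d)) : ∀ (n : ℕ) (x y : Site d), killedKernel I n x y ≤ srwKernel n x y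
  | 0, x, y => by
      simp only [killedKernel, srwKernel]
      split_ifs <;> simp_all
  | n + 1, x, y => by
      simp only [killedKernel, srwKernel]
      split_ifs
      exacts [avg_mono fun l => ⟨killedKernel_le_srwKernel I n _ _, killedKernel_le_srwKernel I n _ _⟩,
        srwKernel_nonneg (n + 1) x y]

/-- ROW MASS: `Σ_{y∈I} K_n(x,y) ≤ 1` (the killed walk is substochastic). -/
theorem killedKernel_rowMass_le_one (hd : 0 < d) (I : Finset (Site d)) :
    ∀ (n : ℕ) (x : Site d), ∑ y ∈ I, killedKernel I n x y ≤ 1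
  | 0, x => by
      by_cases hx : x ∈ I
      · simp [killedKernel, hx, Finset.sum_ite_eq]
      · simp [killedKernel, hx]
  | n + 1, x => by
      by_cases hx : x ∈ I
      · simp only [killedKernel, if_pos hx]
        rw [← avg_sum]
        calc avg (fun z => ∑ y ∈ I, killedKernel I n z y) x ≤ avg (fun _ => (1 : ℝ)) x :=
              avg_mono fun l => ⟨killedKernel_rowMass_le_one hd I n _, killedKernel_rowMass_le_one hd I n _⟩
          _ = 1 := avg_const hd 1 x
      · simp [killedKernel, hx]

/-- The row mass is nonnegative. -/
theorem killedKernel_rowMass_nonneg (I : Finset (Site d)) (n : ℕ) (x : Site d) : 0 ≤ ∑ y ∈ I, killedKernel I n x y :=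
  Finset.sum_nonneg fun y _ => killedKernel_nonneg I n x y

/-! ## §3 The iteration inequality -/

/-- The `n`-th iterate bound `Φ_n(z) := Σ_{y∈I} K_n(z,y)s(y) + b·(1 − Σ_{y∈I} K_n(z,y)) + n·κ∕2d`: mass still inside `I`
carries `s`, mass that has left carries the boundary value `b`, and each step pays the source `κ∕2d`. -/
def iterBound (I : Finset (Site d)) (s : Site d → ℝ) (b κ : ℝ) (n : ℕ) (z : Site d) : ℝ :=
  (∑ y ∈ I, killedKernel I n z y * s y) + b * (1 - ∑ y ∈ I, killedKernel I n z y) + (n : ℝ) * (κ / (2 * (d : ℝ)))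

/-- `Φ_0 = s` on `I`. -/
theorem iterBound_zero {I : Finset (Site d)} (s : Site d → ℝ) (b κ : ℝ) {z : Site d} (hz : z ∈ I) :
    iterBound I s b κ 0 z = s z := by
  simp [iterBound, killedKernel, hz, Finset.sum_ite_eq]

/-- `Φ_n = b + nκ∕2d` off `I`. -/
theorem iterBound_of_not_mem {I : Finset (Site d)} (s : Site d → ℝ) (b κ : ℝ) (n : ℕ) {z : Site d} (hz : z ∉ I) :
    iterBound I s b κ n z = b + (n : ℝ) * (κ / (2 * (d : ℝ))) := by
  simp [iterBound, killedKernel_of_not_mem hz]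

/-- THE RECURSION `Φ_{n+1}(z) = (avg Φ_n)(z) + κ∕2d` on `I` (`avg` is affine). -/
theorem iterBound_succ (hd : 0 < d) {I : Finset (Site d)} (s : Site d → ℝ) (b κ : ℝ) (n : ℕ) {z : Site d}
    (hz : z ∈ I) : iterBound I s b κ (n + 1) z = avg (iterBound I s b κ n) z + κ / (2 * (d : ℝ)) := by
  have hK : ∀ y, killedKernel I (n + 1) z y = avg (fun w => killedKernel I n w y) z := fun y => by
    simp [killedKernel, hz]
  have havg : avg (iterBound I s b κ n) z
      = (∑ y ∈ I, avg (fun w => killedKernel I n w y) z * s y)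
        + b * (1 - ∑ y ∈ I, avg (fun w => killedKernel I n w y) z) + (n : ℝ) * (κ / (2 * (d : ℝ))) := by
    unfold iterBound
    rw [avg_add, avg_add, avg_sum, avg_mul_left, avg_sub, avg_const hd, avg_const hd, avg_sum]
    simp only [avg_mul_right]
  rw [havg]
  simp only [iterBound, hK]
  push_cast
  ring

/-- **THE ITERATION INEQUALITY.** If `2d·s(x) ≤ Σ_{λ,±} s(x±e_λ) + κ` on `I` (`κ ≥ 0`) and `s ≤ b` on `layer I`, then
`s(x) ≤ Φ_n(x) = Σ_{y∈I} K_n(x,y)s(y) + b(1 − Σ_{y∈I}K_n(x,y)) + nκ∕2d` for every `n` and every `x ∈ I`. -/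
theorem le_iterBound (hd : 0 < d) {I : Finset (Site d)} {s : Site d → ℝ} {κ b : ℝ} (hκ : 0 ≤ κ)
    (hsub : ∀ x ∈ I, 2 * (d : ℝ) * s x ≤ (∑ l : Fin d, (s (x + e l) + s (x - e l))) + κ)
    (hbdry : ∀ y ∈ layer I, s y ≤ b) : ∀ (n : ℕ), ∀ x ∈ I, s x ≤ iterBound I s b κ n x
  | 0, x, hx => (iterBound_zero s b κ hx).symm.le
  | n + 1, x, hx => by
      have hd' : (0 : ℝ) < 2 * (d : ℝ) := by positivity
      -- (i) divided by `2d`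
      have hstep : s x ≤ avg s x + κ / (2 * (d : ℝ)) := by
        have h := hsub x hx
        have : avg s x + κ / (2 * (d : ℝ)) = ((∑ l : Fin d, (s (x + e l) + s (x - e l))) + κ) / (2 * (d : ℝ)) := by
          unfold avg
          field_simp
        rw [this, le_div_iff₀ hd']
        linarith
      -- every neighbour value is below `Φ_n` there: inside by induction, outside by the boundary bound
      have hnb : ∀ z : Site d, (z ∈ I ∨ z ∈ layer I) → s z ≤ iterBound I s b κ n z := by
        rintro z (hzI | hzL)
        · exact le_iterBound hd hκ hsub hbdry n z hzI
        · have hz : z ∉ I := (Finset.mem_sdiff.mp hzL).2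
          rw [iterBound_of_not_mem s b κ n hz]
          have : (0 : ℝ) ≤ (n : ℝ) * (κ / (2 * (d : ℝ))) := by positivity
          linarith [hbdry z hzL]
      have hmono : avg s x ≤ avg (iterBound I s b κ n) x := by
        refine avg_mono fun l => ⟨hnb _ ?_, hnb _ ?_⟩
        · by_cases h : x + e l ∈ I
          · exact Or.inl h
          · exact Or.inr ((mem_layer_of_not_mem hx l).1 h)
        · by_cases h : x - e l ∈ I
          · exact Or.inl h
          · exact Or.inr ((mem_layer_of_not_mem hx l).2 h)
      rw [iterBound_succ hd s b κ n hx]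
      linarith

/-! ## §4 Hölder with the row mass, and THEOREM A -/

/-- HÖLDER WITH THE ROW MASS: if `0 ≤ K ≤ ψ` on `t` and `Σ_t K ≤ 1`, then `(Σ_t K·s)² ≤ ψ·Σ_t s²` (Cauchy–Schwarz for
`√K · (√K s)`; no sign condition on `s`). -/
theorem sq_sum_mul_le {ι : Type*} (t : Finset ι) (K s : ι → ℝ) {ψ : ℝ} (hK0 : ∀ y ∈ t, 0 ≤ K y)
    (hKψ : ∀ y ∈ t, K y ≤ ψ) (hmass : ∑ y ∈ t, K y ≤ 1) :
    (∑ y ∈ t, K y * s y) ^ 2 ≤ ψ * ∑ y ∈ t, s y ^ 2 := by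
  have hcs := Finset.sum_mul_sq_le_sq_mul_sq t (fun y => Real.sqrt (K y)) (fun y => Real.sqrt (K y) * s y)
  have h1 : ∑ y ∈ t, Real.sqrt (K y) * (Real.sqrt (K y) * s y) = ∑ y ∈ t, K y * s y :=
    Finset.sum_congr rfl fun y hy => by rw [← mul_assoc, Real.mul_self_sqrt (hK0 y hy)]
  have h2 : ∑ y ∈ t, Real.sqrt (K y) ^ 2 = ∑ y ∈ t, K y :=
    Finset.sum_congr rfl fun y hy => Real.sq_sqrt (hK0 y hy)
  have h3 : ∑ y ∈ t, (Real.sqrt (K y) * s y) ^ 2 = ∑ y ∈ t, K y * s y ^ 2 :=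
    Finset.sum_congr rfl fun y hy => by rw [mul_pow, Real.sq_sqrt (hK0 y hy)]
  rw [h1, h2, h3] at hcs
  have h4 : 0 ≤ ∑ y ∈ t, K y * s y ^ 2 := Finset.sum_nonneg fun y hy => mul_nonneg (hK0 y hy) (sq_nonneg _)
  have h5 : ∑ y ∈ t, K y * s y ^ 2 ≤ ψ * ∑ y ∈ t, s y ^ 2 := by
    rw [Finset.mul_sum]
    exact Finset.sum_le_sum fun y hy => mul_le_mul_of_nonneg_right (hKψ y hy) (sq_nonneg _)
  calc (∑ y ∈ t, K y * s y) ^ 2 ≤ (∑ y ∈ t, K y) * ∑ y ∈ t, K y * s y ^ 2 := hcs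
    _ ≤ 1 * ∑ y ∈ t, K y * s y ^ 2 := mul_le_mul_of_nonneg_right hmass h4
    _ ≤ ψ * ∑ y ∈ t, s y ^ 2 := by rw [one_mul]; exact h5

/-- **THEOREM A (DISPERSION BOUND; every `d ≥ 1`, every `n`).** If `2d·s(x) ≤ Σ_{λ,±} s(x±e_λ) + κ` on a finite `I`
(`κ ≥ 0`), `s ≤ b` on `layer I` (`b ≥ 0`), and the free kernel satisfies `P_n(p₀, y) ≤ ψ` for `y ∈ I`, then at every
`p₀ ∈ I`: `s(p₀) ≤ √(ψ · Σ_{y∈I} s(y)²) + b + n·κ∕2d`. The value at a point is paid for by the energy the walk can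
still see after `n` steps, the boundary value, and `n` source quanta. -/
theorem dispersion_bound (hd : 0 < d) {I : Finset (Site d)} {s : Site d → ℝ} {κ b : ℝ} (hκ : 0 ≤ κ) (hb : 0 ≤ b)
    (hsub : ∀ x ∈ I, 2 * (d : ℝ) * s x ≤ (∑ l : Fin d, (s (x + e l) + s (x - e l))) + κ)
    (hbdry : ∀ y ∈ layer I, s y ≤ b) (n : ℕ) {p₀ : Site d} (hp₀ : p₀ ∈ I) {ψ : ℝ}
    (hψ : ∀ y ∈ I, srwKernel n p₀ y ≤ ψ) :
    s p₀ ≤ Real.sqrt (ψ * ∑ y ∈ I, s y ^ 2) + b + (n : ℝ) * (κ / (2 * (d : ℝ))) := by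
  have hit := le_iterBound hd hκ hsub hbdry n p₀ hp₀
  have hsq := sq_sum_mul_le I (fun y => killedKernel I n p₀ y) s (fun y _ => killedKernel_nonneg I n p₀ y)
    (fun y hy => (killedKernel_le_srwKernel I n p₀ y).trans (hψ y hy)) (killedKernel_rowMass_le_one hd I n p₀)
  have hKs : ∑ y ∈ I, killedKernel I n p₀ y * s y ≤ Real.sqrt (ψ * ∑ y ∈ I, s y ^ 2) :=
    (le_abs_self _).trans (Real.abs_le_sqrt hsq)
  have hbb : b * (1 - ∑ y ∈ I, killedKernel I n p₀ y) ≤ b :=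
    mul_le_of_le_one_right hb (by linarith [killedKernel_rowMass_nonneg I n p₀])
  unfold iterBound at hit
  linarith

/-! ## §5 THEOREM B: the energy quantum in four dimensions, and the dichotomy (L1) -/

/-- The uniform kernel hypothesis forces `C ≥ 1∕8` (read off at `n = 1`, `y = x + e₀`; `d = 4`). -/
theorem one_div_eight_le_of_kernel_bound {C : ℝ}
    (hC : ∀ (n : ℕ) (x y : Site 4), 0 < n → (n : ℝ) ^ 2 * srwKernel n x y ≤ C) (x : Site 4) : 1 / 8 ≤ C := by
  have h := hC 1 x (x + e (0 : Fin 4)) one_pos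
  have hge := srwKernel_one_neighbour_ge x (0 : Fin 4)
  norm_num at h hge
  linarith

/-- **THEOREM B — THE ENERGY QUANTUM (μ) IN `d = 4`.** `I ⊂ ℤ⁴` finite, `s : ℤ⁴ → ℝ`, constants `C′ > 0`, `b ≥ 0`,
`η > 0`, `M`, a point `p₀ ∈ I` with `M ≤ s(p₀)`. Suppose
(i) `8·s(x) ≤ Σ_{λ,±} s(x±e_λ) + C′M²` for `x ∈ I`; (ii) `s(y) ≤ b` for `y ∈ layer I`; (iii) `(1+η)·b < M`; and the
heat-kernel bound `hC : n²·P_n(x,y) ≤ C` (`n ≥ 1`; Lawler 1991 Thm 1.2.1's uniform corollary, optimal `8∕π²`). Then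
`Σ_{x∈I} s(x)² ≥ η⁴ ∕ ((1+η)⁴·C·C′²)` — INDEPENDENT OF `M`. Proof: `dispersion_bound` with `N = ⌊4η∕((1+η)C′M)⌋` steps
(source cost `≤ ηM∕2(1+η)`, boundary `< M∕(1+η)`, so the walk still sees `≥ ηM∕2(1+η)`), `ψ = C∕N²`; `N = 0` means
`M > 4η∕((1+η)C′)` and `s(p₀)² ≥ M²` alone suffices (`C ≥ 1∕8`). -/
theorem energy_quantum {I : Finset (Site 4)} {s : Site 4 → ℝ} {C C' b η M : ℝ} {p₀ : Site 4}
    (hC : ∀ (n : ℕ) (x y : Site 4), 0 < n → (n : ℝ) ^ 2 * srwKernel n x y ≤ C)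
    (hC' : 0 < C') (hb : 0 ≤ b) (hη : 0 < η)
    (hsub : ∀ x ∈ I, 8 * s x ≤ (∑ l : Fin 4, (s (x + e l) + s (x - e l))) + C' * M ^ 2)
    (hbdry : ∀ y ∈ layer I, s y ≤ b) (hp₀ : p₀ ∈ I) (hMp : M ≤ s p₀) (hgap : (1 + η) * b < M) :
    η ^ 4 / ((1 + η) ^ 4 * C * C' ^ 2) ≤ ∑ x ∈ I, s x ^ 2 := by
  have hη1 : (0 : ℝ) < 1 + η := by linarith
  have hM : 0 < M := lt_of_le_of_lt (by positivity) hgap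
  have hC8 : 1 / 8 ≤ C := one_div_eight_le_of_kernel_bound hC p₀
  have hCpos : 0 < C := by linarith
  have hbM : b < M / (1 + η) := by rw [lt_div_iff₀ hη1]; linarith
  set S := ∑ x ∈ I, s x ^ 2 with hS
  have hS0 : 0 ≤ S := Finset.sum_nonneg fun x _ => sq_nonneg _
  have hSp : s p₀ ^ 2 ≤ S := Finset.single_le_sum (f := fun x => s x ^ 2) (fun x _ => sq_nonneg _) hp₀
  -- the number of affordable steps
  set z : ℝ := 4 * η / ((1 + η) * C' * M) with hz
  have hz0 : 0 ≤ z := by positivity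
  have hMz : M * z = 4 * η / ((1 + η) * C') := by rw [hz]; field_simp
  set N : ℕ := ⌊z⌋₊ with hN
  have hNz : (N : ℝ) ≤ z := Nat.floor_le hz0
  -- target constant, written as a square over `C`
  have hkey : η ^ 4 / ((1 + η) ^ 4 * C * C' ^ 2) = (η / (2 * (1 + η)) * (2 * η / ((1 + η) * C'))) ^ 2 / C := by
    field_simp
  rcases Nat.eq_zero_or_pos N with hN0 | hNpos
  · -- N = 0: `M > 4η/((1+η)C′)`, and `s(p₀)² ≥ M²` is already above the quantum
    have hz1 : z < 1 := Nat.floor_eq_zero.mp (hN ▸ hN0 : ⌊z⌋₊ = 0)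
    have hMlow : 4 * η / ((1 + η) * C') < M := by
      rw [← hMz]; nlinarith
    have hM2 : M ^ 2 ≤ S := le_trans (pow_le_pow_left₀ hM.le hMp 2) hSp
    have hq : η ^ 4 / ((1 + η) ^ 4 * C * C' ^ 2) ≤ (4 * η / ((1 + η) * C')) ^ 2 := by
      rw [div_le_iff₀ (by positivity)]
      have h16 : η ^ 2 ≤ 16 * C * (1 + η) ^ 2 := by nlinarith
      have : (4 * η / ((1 + η) * C')) ^ 2 * ((1 + η) ^ 4 * C * C' ^ 2) = 16 * C * (1 + η) ^ 2 * η ^ 2 := by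
        field_simp; ring
      rw [this]
      nlinarith
    have hlow2 : (4 * η / ((1 + η) * C')) ^ 2 < M ^ 2 := pow_lt_pow_left₀ hMlow (by positivity) two_ne_zero
    linarith
  · -- N ≥ 1: run the walk
    have hNr : (0 : ℝ) < N := by exact_mod_cast hNpos
    have hψ : ∀ y ∈ I, srwKernel N p₀ y ≤ C / (N : ℝ) ^ 2 := fun y _ => by
      rw [le_div_iff₀ (by positivity)]; linarith [hC N p₀ y hNpos]
    have hsub' : ∀ x ∈ I, 2 * ((4 : ℕ) : ℝ) * s x ≤ (∑ l : Fin 4, (s (x + e l) + s (x - e l))) + C' * M ^ 2 :=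
      fun x hx => by have := hsub x hx; push_cast; linarith
    have hA := dispersion_bound (d := 4) (by norm_num) (by positivity : 0 ≤ C' * M ^ 2) hb hsub' hbdry N hp₀ hψ
    have hcost : (N : ℝ) * (C' * M ^ 2 / (2 * ((4 : ℕ) : ℝ))) ≤ η * M / (2 * (1 + η)) := by
      have : z * (C' * M ^ 2 / 8) = η * M / (2 * (1 + η)) := by
        rw [hz]; field_simp; ring
      calc (N : ℝ) * (C' * M ^ 2 / (2 * ((4 : ℕ) : ℝ))) = (N : ℝ) * (C' * M ^ 2 / 8) := by norm_num
        _ ≤ z * (C' * M ^ 2 / 8) := mul_le_mul_of_nonneg_right hNz (by positivity)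
        _ = _ := this
    -- what the walk still sees
    have ha0 : 0 ≤ η / (2 * (1 + η)) * M := by positivity
    have hsee : η / (2 * (1 + η)) * M < Real.sqrt (C / (N : ℝ) ^ 2 * S) := by
      have : η / (2 * (1 + η)) * M = M - M / (1 + η) - η * M / (2 * (1 + η)) := by field_simp; ring
      rw [this]; linarith
    have hsee2 : (η / (2 * (1 + η)) * M) ^ 2 < C / (N : ℝ) ^ 2 * S := (Real.lt_sqrt ha0).mp hsee
    have hsee3 : (η / (2 * (1 + η)) * M * N) ^ 2 < C * S := by
      rw [show (η / (2 * (1 + η)) * M * N) ^ 2 = (η / (2 * (1 + η)) * M) ^ 2 * (N : ℝ) ^ 2 by ring]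
      calc (η / (2 * (1 + η)) * M) ^ 2 * (N : ℝ) ^ 2 < C / (N : ℝ) ^ 2 * S * (N : ℝ) ^ 2 :=
            mul_lt_mul_of_pos_right hsee2 (by positivity)
        _ = C * S := by field_simp
    -- the floor costs at most a factor 2: `z < N + 1 ≤ 2N`
    have hzN : z < 2 * (N : ℝ) := by
      have h1 : z < (N : ℝ) + 1 := by rw [hN]; exact Nat.lt_floor_add_one z
      have h2 : (1 : ℝ) ≤ N := by exact_mod_cast hNpos
      linarith
    have hMN : 2 * η / ((1 + η) * C') < M * N := by
      rw [show 2 * η / ((1 + η) * C') = M * z / 2 by rw [hMz]; ring]; nlinarith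
    have hprod : η / (2 * (1 + η)) * (2 * η / ((1 + η) * C')) < η / (2 * (1 + η)) * M * N := by
      rw [mul_assoc]; exact mul_lt_mul_of_pos_left hMN (by positivity)
    have hprod2 : (η / (2 * (1 + η)) * (2 * η / ((1 + η) * C'))) ^ 2 < (η / (2 * (1 + η)) * M * N) ^ 2 :=
      pow_lt_pow_left₀ hprod (by positivity) two_ne_zero
    rw [hkey, div_le_iff₀ hCpos]
    nlinarith

/-- **THE DICHOTOMY (L1), scalar form (`d = 4`).** With `p₀ ∈ I` a maximiser of `s` on `I`, (i) with source `C′·s(p₀)²`,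
(ii) `s ≤ b` on `layer I`, and `hC`: EITHER `s ≤ (1+η)·b` on `I` (the branch that IS the sup bound — no Hessian, no
uniqueness, no `κ`-clause), OR the energy carries the quantum `Σ_{x∈I} s(x)² ≥ η⁴∕((1+η)⁴·C·C′²)`. -/
theorem dichotomy {I : Finset (Site 4)} {s : Site 4 → ℝ} {C C' b η : ℝ} {p₀ : Site 4}
    (hC : ∀ (n : ℕ) (x y : Site 4), 0 < n → (n : ℝ) ^ 2 * srwKernel n x y ≤ C)
    (hC' : 0 < C') (hb : 0 ≤ b) (hη : 0 < η) (hp₀ : p₀ ∈ I) (hmax : ∀ x ∈ I, s x ≤ s p₀)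
    (hsub : ∀ x ∈ I, 8 * s x ≤ (∑ l : Fin 4, (s (x + e l) + s (x - e l))) + C' * s p₀ ^ 2)
    (hbdry : ∀ y ∈ layer I, s y ≤ b) :
    (∀ x ∈ I, s x ≤ (1 + η) * b) ∨ η ^ 4 / ((1 + η) ^ 4 * C * C' ^ 2) ≤ ∑ x ∈ I, s x ^ 2 := by
  by_cases h : s p₀ ≤ (1 + η) * b
  · exact Or.inl fun x hx => (hmax x hx).trans h
  · exact Or.inr (energy_quantum hC hC' hb hη hsub hbdry hp₀ le_rfl (not_le.mp h))

end Summit.QuantumFields.BalabanUV.T4Continuum.NE7b.EnergyQuantumLemma
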